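import Literature.NumberTheory.Sieve.NairTenenbaumTheorem1Printed
import Literature.NumberTheory.Sieve.DivisorBound
import Literature.NumberTheory.Sieve.BombieriAsymptoticSieveLemma11T
import Literature.NumberTheory.Sieve.PolynomialCongruencesRootCount
import Summits.Parity.BatemanHorn.Theorems.SoloInformedDivisorSumErdosBounds
import Summits.Parity.BatemanHorn.Theorems.SoloInformedTauRhoEulerMajorant

/-!
# Erdős's upper bound `∑_{n≤x} τ(|g(n)|) ≪ x log x` from Nair–Tenenbaum (named fact), and the
located root count `Mid_g ≪ x log x`

Solo informed line (Parity / Bateman–Horn), session 137.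

For an irreducible `g ∈ ℤ[X]` of positive degree with positive leading coefficient and no fixed
prime divisor (`IsBatemanHornSystem ![g]`), Erdős (J. London Math. Soc. 27 (1952) 7–15)
proved `∑_{n ≤ x} τ(g(n)) ≍ x log x`.  The tree holds the lower bound unconditionally with the
constant `2A_g` (`SoloInformedDivisorSumErdosBounds`); this file derives the UPPER bound from the
tree's NAMED FACT `NairTenenbaum1998_theorem1_printed` (Nair–Tenenbaum, Acta Math. 180 (1998),
Theorem 1 as printed; used with `k = 1`, `F = τ`, `y = x = N`, `ε = 1/(16d²)` where `d = deg g`,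
`δ = 1/2`), i.e. as a theorem conditional on that vendored hypothesis and on nothing else.  The
elementary inputs (the Euler majorant `∑_{m ≤ N} τ(m)ρ_g(m)/m ≤ e^{32W} P_g(N)⁻²` and the Mertens
lower bound `P_g(N) ≥ c/log N`, both PROVED) are in `SoloInformedTauRhoEulerMajorant`.

* `isClassM_card_divisors`, `isClassMk_one_card_divisors` — `τ ∈ 𝓜(2, B, η)` (and `𝓜₁`) for
  every `η > 0` (divisor bound + `τ ≤ 2^Ω`), so the fact applies to `F = τ`;
* `sum_Ioc_card_divisors_le_of_NT` — one Nair–Tenenbaum block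
  `∑_{N<n≤2N} τ(|g(n)|) ≤ K · N log N` for `N ≥ N₀` (fact × majorant × Mertens lower bound, with
  `ρ_g(p^a) ≤ W = d·M_g` from the tree's `exists_polyRootCountMod_prime_pow_le`);
* `exists_polyDivisorSum_le_mul_log_of_NT` — **Erdős's upper bound** `S_g(x) ≤ K x log x` for all
  `x ≥ 2`, by dyadic induction (`S_g(x) ≤ S_g(⌈x/2⌉) + block`);
* `exists_polyLocatedRootCount_le_mul_log_of_NT` — hence, through the landed equivalence
  `polyDivisorSum_upper_iff_located_upper`, the located root count past `x` satisfies
  `Mid_g(x) ≤ K x log x` (`deg g ≥ 2`): the Chebyshev-order upper half of the located-root-count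
  conjecture `Mid_g(x) ∼ ((d−2)/2) A_g x log x` of `SoloInformedErdosConstantConjecture`,
  conditional on the Nair–Tenenbaum fact only;
* the sign symmetry `g ↦ −g` (`polyDivisorSum_neg`, `polyLocatedRootCount_neg`, `…_of_NT_neg`)
  covers `IsBatemanHornSystem ![-g]` (negative leading coefficient) too.

No definitions; no named fact is introduced; the only hypothesis beyond the data is
`NairTenenbaum1998_theorem1_printed`.
-/


open Finset Real Polynomial Filter Topology
open scoped ArithmeticFunction.Omega ArithmeticFunction.sigma

namespace Summit.Parity.BatemanHorn.Theorems

open Literature.NumberTheory.Sieve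

/-! ### `τ` is of class `𝓜(2, B, η)` -/

/-- `τ ∈ 𝓜(2, B, η)` for every `η > 0`, with some `B ≥ 1` (the divisor bound and `τ ≤ 2^Ω`). [folklore] -/
theorem isClassM_card_divisors {η : ℝ} (hη : 0 < η) :
    ∃ B : ℝ, 1 ≤ B ∧ IsClassM 2 B η (fun n => (#n.divisors : ℝ)) := by
  obtain ⟨C, hC1, hC⟩ := exists_card_divisors_le_mul_rpow' hη
  refine ⟨C, hC1, isClassM_of_mul_of_le (fun n => by positivity) ?_ ?_ ?_⟩
  · intro m n hmn
    exact_mod_cast Nat.Coprime.card_divisors_mul hmn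
  · intro m hm
    exact_mod_cast BombieriSieve.card_divisors_le_two_pow_cardFactors (n := m) (by omega)
  · intro m _
    exact hC m

/-- The one-variable product function `n ↦ ∏_{j : Fin 1} τ(n j)` is of class `𝓜₁(2, B, η)`. [folklore] -/
theorem isClassMk_one_card_divisors {η : ℝ} (hη : 0 < η) :
    ∃ B : ℝ, 1 ≤ B ∧ IsClassMk 1 2 B η (fun n : Fin 1 → ℕ => ∏ j, (#(n j).divisors : ℝ)) := by
  obtain ⟨B, hB1, hB⟩ := isClassM_card_divisors hη
  refine ⟨B, hB1, ?_⟩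
  have h := isClassMk_prod (k := 1) (A := 2) (B := B) (ε := η) (by norm_num) (by linarith)
    (F := fun _ : Fin 1 => fun n : ℕ => (#n.divisors : ℝ)) (fun _ => hB)
  simpa using h

/-! ### One Nair–Tenenbaum block `(N, 2N]` -/

/-- The Nair–Tenenbaum right-hand sum for `k = 1`, `F = τ`, is `∑_{m ≤ N} τ(m)ρ_g(m)/m`. [folklore] -/
theorem sum_piFinset_fin_one_eq (g : ℤ[X]) (N : ℕ) :
    ∑ x ∈ (Fintype.piFinset fun _ : Fin 1 => Icc 1 N) with x 0 ≤ N,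
        (#(x 0).divisors : ℝ) * ((polyRootCountMod ![g] (x 0) : ℝ) / (x 0)) =
      ∑ m ∈ Icc 1 N, ((#m.divisors : ℝ) * (polyRootCountMod ![g] m : ℝ) / m) := by
  refine Finset.sum_nbij' (fun n => n 0) (fun m _ => m) ?_ ?_ ?_ ?_ ?_
  · intro n hn
    simp only [mem_filter, Fintype.mem_piFinset] at hn
    exact hn.1 0
  · intro m hm
    simp only [mem_filter, Fintype.mem_piFinset]
    exact ⟨fun _ => hm, (mem_Icc.mp hm).2⟩
  · intro n _
    funext j
    simp [Fin.eq_zero j]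
  · intro m _
    rfl
  · intro n _
    simp only [mul_div_assoc]

/-- The terms of `∑ τ(|g(n)|)` vanish at the roots of `g`, so the root-free restriction of the sum
is the sum itself. [folklore] -/
theorem sum_filter_eval_ne_zero_card_divisors (g : ℤ[X]) (s : Finset ℕ) :
    ∑ x ∈ s with g.eval ((x : ℕ) : ℤ) ≠ 0, (#((g.eval ((x : ℕ) : ℤ)).natAbs.divisors) : ℝ) =
      ∑ x ∈ s, (#((g.eval ((x : ℕ) : ℤ)).natAbs.divisors) : ℝ) := by
  refine Finset.sum_filter_of_ne fun x _ hx => ?_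
  intro h0
  apply hx
  simp [h0]

/-- **One Nair–Tenenbaum block.**  Assuming the named fact `NairTenenbaum1998_theorem1_printed`
(`k = 1`, `F = τ ∈ 𝓜(2, B, εδ/3)`, `ε = 1/(16 d²)`, `δ = 1/2`, `y = x = N`): for `g` a one-polynomial
Bateman–Horn system of degree `d ≥ 1` there are `N₀` and `K` with
`∑_{N < n ≤ 2N} τ(|g(n)|) ≤ K · N log N` for all `N ≥ N₀`.
[cite: NairTenenbaum1998, Theorem 1 (p. 125)]; [this work] -/
theorem sum_Ioc_card_divisors_le_of_NT (hNT : NairTenenbaum1998_theorem1_printed) {g : ℤ[X]}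
    (hg : IsBatemanHornSystem ![g]) (hdeg : 0 < g.natDegree) :
    ∃ (N₀ : ℕ) (K : ℝ), 0 ≤ K ∧ ∀ N : ℕ, N₀ ≤ N →
      (∑ n ∈ Ioc N (2 * N), (#((g.eval (n : ℤ)).natAbs.divisors) : ℝ)) ≤ K * ((N : ℝ) * Real.log N) := by
  set d : ℕ := g.natDegree with hd_def
  have hd1 : (1 : ℝ) ≤ d := by exact_mod_cast hdeg
  set ε : ℝ := 1 / (16 * (d : ℝ) ^ 2) with hε_def
  set δ : ℝ := 1 / 2 with hδ_def
  have hε : 0 < ε := by positivity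
  have hε' : ε < 1 / (8 * (d : ℝ) ^ 2) := by
    rw [hε_def]
    apply one_div_lt_one_div_of_lt (by positivity)
    nlinarith
  obtain ⟨B, hB1, hB⟩ := isClassMk_one_card_divisors (η := ε * δ / 3) (by positivity)
  obtain ⟨c₀, C, hC⟩ := hNT 1 d g.discr 2 B ε δ le_rfl (by norm_num) hB1 hε hε' (by norm_num)
    (by norm_num)
  have hirr0 : Irreducible g := by simpa using hg.irreducible 0
  have hirr : ∀ j : Fin 1, Irreducible ((![g] : Fin 1 → ℤ[X]) j) := fun j => by
    simpa using hg.irreducible j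
  have hQ := hC ![g] hirr (fun i j hij => absurd (Subsingleton.elim i j) hij)
    hg.hasNoFixedPrimeDivisor (by simp [hd_def]) (by simp) _ hB
  have hmain := fun N : ℕ => hQ (N : ℝ) (N : ℝ)
  simp only [Fin.prod_univ_one, Matrix.cons_val_zero, Nat.floor_natCast, Fin.isValue] at hmain
  -- the prime-power bound `ρ_g(p^a) ≤ W` and the Mertens lower bound `P_g(N) ≥ c / log N`
  obtain ⟨M, -, hM⟩ := exists_polyRootCountMod_prime_pow_le hirr0 hdeg
  set W : ℝ := (d : ℝ) * M with hW_def
  have hW : ∀ p : ℕ, p.Prime → ∀ a : ℕ, (polyRootCountMod ![g] (p ^ a) : ℝ) ≤ W := fun p hp a => by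
    have := hM p hp a
    simp only [hW_def, hd_def]
    exact_mod_cast this
  obtain ⟨c, hc, hcP⟩ := exists_pos_le_log_mul_sieveProd hg
  set C' : ℝ := max C 0 with hC'_def
  have hC'0 : 0 ≤ C' := le_max_right _ _
  refine ⟨⌈c₀ * (polyHeight g : ℝ) ^ δ⌉₊ + 2, C' * Real.exp (32 * W) / c, by positivity,
    fun N hN => ?_⟩
  have hN2 : 2 ≤ N := le_of_add_le_right hN
  have hNr : (2 : ℝ) ≤ N := by exact_mod_cast hN2
  have hN0 : (0 : ℝ) < N := by linarith
  have hlogN : 0 < Real.log N := Real.log_pos (by linarith)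
  -- the three side conditions of the fact at `x = y = N`
  have hx : c₀ * (polyHeight g : ℝ) ^ δ ≤ (N : ℝ) := by
    have h1 := Nat.le_ceil (c₀ * (polyHeight g : ℝ) ^ δ)
    have h2 : (⌈c₀ * (polyHeight g : ℝ) ^ δ⌉₊ : ℝ) ≤ N := by
      exact_mod_cast (Nat.le_add_right _ 2).trans hN
    linarith
  have hy : (N : ℝ) ^ (4 * (d : ℝ) ^ 2 * ε) ≤ N := by
    have h14 : 4 * (d : ℝ) ^ 2 * ε = 1 / 4 := by
      rw [hε_def]; field_simp; ring
    rw [h14]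
    calc (N : ℝ) ^ (1 / 4 : ℝ) ≤ (N : ℝ) ^ (1 : ℝ) :=
          Real.rpow_le_rpow_of_exponent_le (by linarith) (by norm_num)
      _ = N := Real.rpow_one _
  have h := hmain N hx hy le_rfl
  -- normalise the four pieces
  have h2N : ⌊(N : ℝ) + N⌋₊ = 2 * N := by
    rw [show (N : ℝ) + N = ((2 * N : ℕ) : ℝ) by push_cast; ring, Nat.floor_natCast]
  -- the primes of `[1, N]` are `Nat.primesLE N` (as in `FriedlanderIwaniecPrimes`)
  have hprimes : (Icc 1 N).filter Nat.Prime = Nat.primesLE N := by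
    ext p
    simp only [mem_filter, mem_Icc, Nat.mem_primesLE]
    exact ⟨fun ⟨⟨_, h⟩, hp⟩ => ⟨h, hp⟩, fun ⟨h, hp⟩ => ⟨⟨hp.one_lt.le, h⟩, hp⟩⟩
  rw [h2N, sum_filter_eval_ne_zero_card_divisors, hprimes, sum_piFinset_fin_one_eq] at h
  -- `h : block ≤ C N P_g(N) · ∑_{m≤N} τρ/m`
  have hP := sieveProd_pos hg.hasNoFixedPrimeDivisor N
  have hT := sum_tauRhoDiv_le_exp_div_sieveProd_sq hg.hasNoFixedPrimeDivisor hW N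
  have hT0 : 0 ≤ ∑ m ∈ Icc 1 N, ((#m.divisors : ℝ) * (polyRootCountMod ![g] m : ℝ) / m) := Finset.sum_nonneg fun m _ => tauRhoDiv_nonneg g m
  have hcP' := hcP N hN2
  have h' : (∑ n ∈ Ioc N (2 * N), (#((g.eval (n : ℤ)).natAbs.divisors) : ℝ)) ≤
      C * N * (∏ p ∈ Nat.primesLE N, (1 - (polyRootCountMod ![g] p : ℝ) / p)) * ∑ m ∈ Icc 1 N, ((#m.divisors : ℝ) * (polyRootCountMod ![g] m : ℝ) / m) := h
  -- make `P = P_g(N)` and `T = ∑ τρ/m` opaque, then chain the inequalities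
  generalize hPdef : (∏ p ∈ Nat.primesLE N, (1 - (polyRootCountMod ![g] p : ℝ) / p)) = P at h' hP hT hcP'
  generalize hTdef : ∑ m ∈ Icc 1 N, ((#m.divisors : ℝ) * (polyRootCountMod ![g] m : ℝ) / m) = T at h' hT hT0
  have hPne : P ≠ 0 := hP.ne'
  have hCC' : C ≤ C' := le_max_left _ _
  -- `1 / P ≤ log N / c`
  have hinvP : P⁻¹ ≤ Real.log N / c := by
    rw [inv_eq_one_div, div_le_div_iff₀ hP hc]
    linarith
  have hPP : P * (P ^ 2)⁻¹ = P⁻¹ := by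
    rw [pow_two, mul_inv, ← mul_assoc, mul_inv_cancel₀ hPne, one_mul]
  calc ∑ n ∈ Ioc N (2 * N), (#((g.eval (n : ℤ)).natAbs.divisors) : ℝ)
      ≤ C * N * P * T := h'
    _ ≤ C' * N * P * T :=
        mul_le_mul_of_nonneg_right (mul_le_mul_of_nonneg_right
          (mul_le_mul_of_nonneg_right hCC' hN0.le) hP.le) hT0
    _ ≤ C' * N * P * (Real.exp (32 * W) * (P ^ 2)⁻¹) :=
        mul_le_mul_of_nonneg_left hT (mul_nonneg (mul_nonneg hC'0 hN0.le) hP.le)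
    _ = C' * Real.exp (32 * W) * N * (P * (P ^ 2)⁻¹) := by ring
    _ = C' * Real.exp (32 * W) * N * P⁻¹ := by rw [hPP]
    _ ≤ C' * Real.exp (32 * W) * N * (Real.log N / c) :=
        mul_le_mul_of_nonneg_left hinvP
          (mul_nonneg (mul_nonneg hC'0 (Real.exp_pos _).le) hN0.le)
    _ = C' * Real.exp (32 * W) / c * ((N : ℝ) * Real.log N) := by ring

/-! ### Erdős's upper bound by dyadic induction -/

/-- `S_g` in real terms. -/
theorem polyDivisorSum_cast (g : ℤ[X]) (x : ℕ) :
    (polyDivisorSum g x : ℝ) = ∑ n ∈ Icc 1 x, (#((g.eval (n : ℤ)).natAbs.divisors) : ℝ) := by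
  simp [polyDivisorSum]

/-- `S_g` is monotone. [folklore] -/
theorem polyDivisorSum_mono (g : ℤ[X]) {x y : ℕ} (hxy : x ≤ y) :
    polyDivisorSum g x ≤ polyDivisorSum g y :=
  Finset.sum_le_sum_of_subset (Icc_subset_Icc_right hxy)

/-- `S_g(2N) = S_g(N) + ∑_{N<n≤2N} τ(|g(n)|)`. [folklore] -/
theorem polyDivisorSum_two_mul (g : ℤ[X]) (N : ℕ) :
    (polyDivisorSum g (2 * N) : ℝ) =
      polyDivisorSum g N + ∑ n ∈ Ioc N (2 * N), (#((g.eval (n : ℤ)).natAbs.divisors) : ℝ) := by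
  -- `[1, X] = (0, X]` in `ℕ` (as in `VonKochConverse`)
  have hIcc : ∀ X : ℕ, Finset.Icc 1 X = Finset.Ioc 0 X := fun X => by
    ext n; simp only [mem_Icc, mem_Ioc]; omega
  rw [polyDivisorSum_cast, polyDivisorSum_cast, hIcc, hIcc, ← Finset.sum_union]
  · congr 1
    exact (Finset.Ioc_union_Ioc_eq_Ioc (Nat.zero_le N) (by omega)).symm
  · exact Finset.disjoint_left.mpr fun n hn hn' => by
      simp only [mem_Ioc] at hn hn'; omega

/-- **Erdős's upper bound from Nair–Tenenbaum.**  Assuming the named fact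
`NairTenenbaum1998_theorem1_printed`: for every `g ∈ ℤ[X]` with `IsBatemanHornSystem ![g]`
(irreducible, positive leading coefficient, no fixed prime divisor) and `deg g ≥ 1` there is `K`
with `∑_{n ≤ x} τ(|g(n)|) ≤ K · x log x` for all integers `x ≥ 2`.
[cite: NairTenenbaum1998, Theorem 1 (p. 125)]; Erdős, J. London Math. Soc. 27 (1952) 7–15; [this work] -/
theorem exists_polyDivisorSum_le_mul_log_of_NT (hNT : NairTenenbaum1998_theorem1_printed) {g : ℤ[X]}
    (hg : IsBatemanHornSystem ![g]) (hdeg : 0 < g.natDegree) :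
    ∃ K : ℝ, ∀ x : ℕ, 2 ≤ x → (polyDivisorSum g x : ℝ) ≤ K * ((x : ℝ) * Real.log x) := by
  obtain ⟨N₀, K, hK0, hblock⟩ := sum_Ioc_card_divisors_le_of_NT hNT hg hdeg
  -- base range `2 ≤ x ≤ B₀`, `B₀ = 2N₀ + 4`
  set B₀ : ℕ := 2 * N₀ + 4 with hB₀
  obtain ⟨S₀, hS₀⟩ : ∃ S₀ : ℝ, S₀ = (polyDivisorSum g B₀ : ℝ) := ⟨_, rfl⟩
  have hS₀0 : 0 ≤ S₀ := hS₀ ▸ Nat.cast_nonneg _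
  have hl2 : (1 : ℝ) / 2 < Real.log 2 := by
    have := Real.log_two_gt_d9; norm_num at this ⊢; linarith
  set K' : ℝ := max (2 * K) S₀ with hK'
  have hK'K : 2 * K ≤ K' := le_max_left _ _
  have hK'S : S₀ ≤ K' := le_max_right _ _
  have hK'0 : 0 ≤ K' := hS₀0.trans hK'S
  refine ⟨K', fun x => ?_⟩
  induction x using Nat.strong_induction_on with
  | _ x ih =>
    intro hx
    have hxr : (2 : ℝ) ≤ x := by exact_mod_cast hx
    have hlogx : Real.log 2 ≤ Real.log x := Real.log_le_log (by norm_num) hxr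
    have hxlogx : (1 : ℝ) ≤ (x : ℝ) * Real.log x := by nlinarith
    by_cases hxB : x ≤ B₀
    · -- base: `S(x) ≤ S₀ ≤ K' ≤ K' x log x`
      calc (polyDivisorSum g x : ℝ) ≤ (polyDivisorSum g B₀ : ℝ) := by
            exact_mod_cast polyDivisorSum_mono g hxB
        _ = S₀ := hS₀.symm
        _ ≤ K' * 1 := by linarith
        _ ≤ K' * ((x : ℝ) * Real.log x) := by gcongr
    · -- step: `N = ⌈x/2⌉`, `S(x) ≤ S(2N) = S(N) + block ≤ K' N log N + K N log N`
      rw [not_le] at hxB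
      set N : ℕ := (x + 1) / 2 with hN
      have hNx : N < x := by omega
      have hN2 : 2 ≤ N := by omega
      have hxN : x ≤ 2 * N := by omega
      have hN₀N : N₀ ≤ N := by omega
      have hNr2 : (2 : ℝ) ≤ N := by exact_mod_cast hN2
      have hN3 : 3 * (N : ℝ) ≤ 2 * x := by
        have : 3 * N ≤ 2 * x := by omega
        exact_mod_cast this
      have hlogN0 : 0 ≤ Real.log N := Real.log_nonneg (by linarith)
      have hlogNx : Real.log N ≤ Real.log x := Real.log_le_log (by linarith) (by exact_mod_cast hNx.le)
      have hIH := ih N hNx hN2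
      have hB := hblock N hN₀N
      calc (polyDivisorSum g x : ℝ) ≤ polyDivisorSum g (2 * N) := by
            exact_mod_cast polyDivisorSum_mono g hxN
        _ = polyDivisorSum g N + ∑ n ∈ Ioc N (2 * N), (#((g.eval (n : ℤ)).natAbs.divisors) : ℝ) :=
            polyDivisorSum_two_mul g N
        _ ≤ K' * ((N : ℝ) * Real.log N) + K * ((N : ℝ) * Real.log N) := add_le_add hIH hB
        _ = (K' + K) * ((N : ℝ) * Real.log N) := by ring
        _ ≤ (K' + K) * ((N : ℝ) * Real.log x) := by gcongr
        _ ≤ K' * ((x : ℝ) * Real.log x) := by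
            -- `(K' + K) N ≤ (3/2) K' N ≤ K' x`
            have h1 : (K' + K) * (N : ℝ) ≤ K' * x := by nlinarith
            have h2 : 0 ≤ Real.log x := by linarith [Real.log_pos (by norm_num : (1:ℝ) < 2)]
            nlinarith

/-- **The located root count is `O(x log x)`** (conditional on Nair–Tenenbaum): for `g` with
`IsBatemanHornSystem ![g]` and `deg g ≥ 2` there is `K` with `Mid_g(x) ≤ K · x log x` for all
`x ≥ 2` — the Chebyshev-order upper half of the located-root-count conjecture
`Mid_g(x) ∼ ((d−2)/2) A_g x log x`, through the landed equivalence
`polyDivisorSum_upper_iff_located_upper`.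
[cite: NairTenenbaum1998, Theorem 1 (p. 125)]; [this work] -/
theorem exists_polyLocatedRootCount_le_mul_log_of_NT (hNT : NairTenenbaum1998_theorem1_printed)
    {g : ℤ[X]} (hg : IsBatemanHornSystem ![g]) (hdeg : 2 ≤ g.natDegree) :
    ∃ K : ℝ, ∀ x : ℕ, 2 ≤ x → (polyLocatedRootCount g x : ℝ) ≤ K * ((x : ℝ) * Real.log x) := by
  have hirr0 : Irreducible g := by simpa using hg.irreducible 0
  exact (polyDivisorSum_upper_iff_located_upper hirr0 hdeg).mp
    (exists_polyDivisorSum_le_mul_log_of_NT hNT hg (by omega))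

/-! ### The sign symmetry `g ↦ −g` -/

/-- `S_{−g} = S_g`. [folklore] -/
theorem polyDivisorSum_neg (g : ℤ[X]) (x : ℕ) : polyDivisorSum (-g) x = polyDivisorSum g x := by
  simp [polyDivisorSum, eval_neg, Int.natAbs_neg]

/-- `Mid_{−g} = Mid_g`. [folklore] -/
theorem polyLocatedRootCount_neg (g : ℤ[X]) (x : ℕ) :
    polyLocatedRootCount (-g) x = polyLocatedRootCount g x := by
  simp [polyLocatedRootCount, eval_neg, Int.natAbs_neg]

/-- Erdős's upper bound for `g` with `IsBatemanHornSystem ![-g]` (negative leading coefficient).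
[cite: NairTenenbaum1998, Theorem 1 (p. 125)]; [this work] -/
theorem exists_polyDivisorSum_le_mul_log_of_NT_neg (hNT : NairTenenbaum1998_theorem1_printed)
    {g : ℤ[X]} (hg : IsBatemanHornSystem ![-g]) (hdeg : 0 < g.natDegree) :
    ∃ K : ℝ, ∀ x : ℕ, 2 ≤ x → (polyDivisorSum g x : ℝ) ≤ K * ((x : ℝ) * Real.log x) := by
  obtain ⟨K, hK⟩ := exists_polyDivisorSum_le_mul_log_of_NT hNT hg (by rwa [natDegree_neg])
  exact ⟨K, fun x hx => by rw [← polyDivisorSum_neg]; exact hK x hx⟩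

/-- The located root count bound for `g` with `IsBatemanHornSystem ![-g]`. [this work] -/
theorem exists_polyLocatedRootCount_le_mul_log_of_NT_neg (hNT : NairTenenbaum1998_theorem1_printed)
    {g : ℤ[X]} (hg : IsBatemanHornSystem ![-g]) (hdeg : 2 ≤ g.natDegree) :
    ∃ K : ℝ, ∀ x : ℕ, 2 ≤ x → (polyLocatedRootCount g x : ℝ) ≤ K * ((x : ℝ) * Real.log x) := by
  obtain ⟨K, hK⟩ := exists_polyLocatedRootCount_le_mul_log_of_NT hNT hg (by rwa [natDegree_neg])
  exact ⟨K, fun x hx => by rw [← polyLocatedRootCount_neg]; exact hK x hx⟩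

end Summit.Parity.BatemanHorn.Theorems
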